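import Summits.Parity.GeneralizedHardyLittlewood.Theorems.LeeYangFibresModelHyperbolicityDefs
import HarnessLib

/-!
# Stub `stub_simpleZeros` of line `window-chain-transport` for crux `LeeYangFibres.ModelHyperbolicity` (stmt-Parity-14110)

We prove `SimpleZerosStep`: granted the density calculus, the window chain (Hermite–Biehler
positivity pair on every unit window) and the no-null-window property, the real model polynomial
`p = modelPoly u = Σ_{j<u} I_{j+1}(u) X^j` has degree `≤ u - 2` and at least `u - 2` distinct real
roots, for every integer `u ≥ 2`.

Proof. Degree: the coefficient of `X^{u-1}` is `I_u(u) = 0` by (C2). For `u ≥ 3` the coefficient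
of `X^{u-2}` is `I_{u-1}(u) > 0` by (C3), so `P := p ⊗ ℂ` has exactly `u - 2` complex roots with
multiplicity. REALITY: `P(z) = G_u(u;z) ≠ 0` for `Im z > 0` (window chain at the pair `(u,u)`), and
by conjugation symmetry (real coefficients) also for `Im z < 0`. SIMPLICITY: if `z₀` (real, `≠ 0`
since `P(0) = 1`) is a root of multiplicity `m ≥ 2`, write `P = (X - z₀)^m Q` with `Q(z₀) ≠ 0`; for
`τ ∈ [u-1, u]` the strict conjunct of the window chain gives `Im(z G_u(τ;z)/P(z)) > 0` on the upper
half-plane; along the ray `z = z₀ + r e^{iθ}` (`0 < θ < π`, `r → 0⁺`) the quantity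
`r^m · z G_u(τ;z)/P(z)` tends to `d e^{-imθ}` with `d = z₀ G_u(τ;z₀)/Q(z₀)`, whence
`Im(d e^{-imθ}) ≥ 0` for all `θ ∈ (0, π)`; since `m ≥ 2` four choices of `mθ ∈ (0, 2π)` force
`d = 0`, i.e. `G_u(τ;z₀) = 0` on the whole window `[u-1,u]`, contradicting `NoNullWindow`. Hence the
roots of `P` are simple and real, so `p` has `u - 2` distinct real roots.

References: line card `Cruxes/ModelHyperbolicity/Lines/window-chain-transport.md`; the pole-order
argument is the standard one for Hermite–Biehler / proper-position pairs (e.g. D. G. Wagner,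
Bull. AMS 48 (2011) §2).
-/

noncomputable section

namespace Summit.Parity.GeneralizedHardyLittlewood.Cruxes.ModelHyperbolicity.WindowChainTransport

open scoped BigOperators
open Polynomial Filter
open scoped Topology

/-! ## Helper lemmas -/

/-- `modelEval N τ` is continuous in `z` (a polynomial). -/
private lemma sz_continuous_modelEval (N : ℕ) (τ : ℝ) : Continuous fun z : ℂ => modelEval N τ z := by
  unfold modelEval
  exact continuous_finsetSum _ fun j _ => continuous_const.mul (continuous_pow j)

/-- Conjugation symmetry of the model family (real coefficients). -/
private lemma sz_modelEval_conj (N : ℕ) (τ : ℝ) (z : ℂ) :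
    modelEval N τ ((starRingEnd ℂ) z) = (starRingEnd ℂ) (modelEval N τ z) := by
  unfold modelEval
  rw [map_sum]
  refine Finset.sum_congr rfl fun j _ => ?_
  rw [map_mul, map_pow, Complex.conj_ofReal]

/-- The imaginary part of `d · e^{-ix}`. -/
private lemma sz_div_exp_im (d : ℂ) (x : ℝ) :
    (d / Complex.exp (x * Complex.I)).im = d.im * Real.cos x - d.re * Real.sin x := by
  rw [div_eq_mul_inv, ← Complex.exp_neg,
    show -((x : ℂ) * Complex.I) = ((-x : ℝ) : ℂ) * Complex.I by push_cast; ring,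
    Complex.exp_ofReal_mul_I, Real.cos_neg, Real.sin_neg]
  simp only [Complex.mul_im, Complex.add_re, Complex.add_im, Complex.ofReal_re, Complex.ofReal_im,
    Complex.mul_re, Complex.I_re, Complex.I_im]
  ring

/-- The angle argument: if `Im(d e^{-imθ}) ≥ 0` for every direction `θ ∈ (0, π)` of the upper
half-plane and `m ≥ 2`, then `d = 0`. -/
private lemma sz_eq_zero_of_forall_angle {d : ℂ} {m : ℕ} (hm : 2 ≤ m)
    (h : ∀ θ : ℝ, 0 < θ → θ < Real.pi → 0 ≤ (d / Complex.exp (θ * Complex.I) ^ m).im) : d = 0 := by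
  have hpi := Real.pi_pos
  have hm0 : (0 : ℝ) < m := by exact_mod_cast (show 0 < m by omega)
  have hm2 : (2 : ℝ) ≤ m := by exact_mod_cast hm
  have key : ∀ x : ℝ, 0 < x → x < 2 * Real.pi → 0 ≤ d.im * Real.cos x - d.re * Real.sin x := by
    intro x hx hx'
    have hlt : x / m < Real.pi := by
      rw [div_lt_iff₀ hm0]
      nlinarith
    have h1 := h (x / m) (div_pos hx hm0) hlt
    have hcast : (m : ℂ) * (((x / m : ℝ) : ℂ) * Complex.I) = (x : ℂ) * Complex.I := by
      have hm' : (m : ℂ) ≠ 0 := by exact_mod_cast (show m ≠ 0 by omega)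
      push_cast
      field_simp
    rwa [← Complex.exp_nat_mul, hcast, sz_div_exp_im] at h1
  have e1 := key (Real.pi / 2) (by positivity) (by linarith)
  have e2 := key (Real.pi / 2 + Real.pi) (by positivity) (by linarith)
  have e3 := key Real.pi hpi (by linarith)
  have e4 := key (Real.pi / 4) (by positivity) (by linarith)
  rw [Real.cos_pi_div_two, Real.sin_pi_div_two] at e1
  rw [Real.cos_add_pi, Real.sin_add_pi, Real.cos_pi_div_two, Real.sin_pi_div_two] at e2
  rw [Real.cos_pi, Real.sin_pi] at e3
  have hre : d.re = 0 := by linarith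
  have hcos : 0 < Real.cos (Real.pi / 4) := Real.cos_pos_of_mem_Ioo ⟨by linarith, by linarith⟩
  rw [hre, zero_mul, sub_zero] at e4
  have him : d.im = 0 := by nlinarith
  exact Complex.ext (by simpa using hre) (by simpa using him)

/-- The pole-order (ray) argument: if `Im(z G(z) / ((z - z₀)^m H(z))) > 0` on the upper half-plane,
`z₀` is real, `G, H` are continuous and `H(z₀) ≠ 0`, then along the ray `z₀ + r e^{iθ}`, `r → 0⁺`,
one gets `Im(z₀ G(z₀)/H(z₀) · e^{-imθ}) ≥ 0`. -/
private lemma sz_ray {G H : ℂ → ℂ} (hG : Continuous G) (hH : Continuous H) {z₀ : ℂ}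
    (hz₀ : z₀.im = 0) {m : ℕ} (hH0 : H z₀ ≠ 0)
    (hpos : ∀ z : ℂ, 0 < z.im → 0 < (z * G z / ((z - z₀) ^ m * H z)).im)
    {θ : ℝ} (hθ : 0 < θ) (hθ' : θ < Real.pi) :
    0 ≤ (z₀ * G z₀ / H z₀ / Complex.exp (θ * Complex.I) ^ m).im := by
  set w : ℂ := Complex.exp (θ * Complex.I) with hw
  have hw0 : w ≠ 0 := Complex.exp_ne_zero _
  have hwim : 0 < w.im := by
    rw [hw, Complex.exp_ofReal_mul_I_im]
    exact Real.sin_pos_of_pos_of_lt_pi hθ hθ'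
  -- the test function and the ray
  obtain ⟨f, hf⟩ : ∃ f : ℂ → ℂ, f = fun z => z * G z / H z / w ^ m := ⟨_, rfl⟩
  obtain ⟨γ, hγ⟩ : ∃ γ : ℝ → ℂ, γ = fun r : ℝ => z₀ + (r : ℂ) * w := ⟨_, rfl⟩
  have hfc : ContinuousAt f z₀ := by
    rw [hf]
    exact ((continuousAt_id.mul hG.continuousAt).div hH.continuousAt hH0).div continuousAt_const
      (pow_ne_zero m hw0)
  have hγc : Continuous γ := by
    rw [hγ]
    fun_prop
  have hγ0 : γ 0 = z₀ := by
    rw [hγ]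
    simp
  have hlim : Tendsto (fun r : ℝ => (f (γ r)).im) (𝓝[>] 0) (𝓝 (f z₀).im) := by
    have h1 : Tendsto γ (𝓝 0) (𝓝 z₀) := by
      have := hγc.tendsto 0
      rwa [hγ0] at this
    have h2 : Tendsto (fun r => f (γ r)) (𝓝 0) (𝓝 (f z₀)) := hfc.tendsto.comp h1
    exact ((Complex.continuous_im.tendsto _).comp h2).mono_left nhdsWithin_le_nhds
  have hev : ∀ᶠ r : ℝ in 𝓝[>] 0, 0 ≤ (f (γ r)).im := by
    refine eventually_nhdsWithin_of_forall fun r hr => ?_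
    have hr : (0 : ℝ) < r := hr
    have hr0 : (r : ℂ) ≠ 0 := Complex.ofReal_ne_zero.mpr hr.ne'
    have him : 0 < (γ r).im := by
      rw [hγ]
      simpa [hz₀] using mul_pos hr hwim
    have key : f (γ r) = (r : ℂ) ^ m * (γ r * G (γ r) / ((γ r - z₀) ^ m * H (γ r))) := by
      rw [hf, hγ]
      simp only [add_sub_cancel_left, mul_pow]
      rw [← mul_div_assoc, mul_assoc, mul_div_mul_left _ _ (pow_ne_zero m hr0), div_div,
        mul_comm (w ^ m)]
    rw [key, ← Complex.ofReal_pow, Complex.im_ofReal_mul]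
    exact le_of_lt (mul_pos (pow_pos hr m) (hpos _ him))
  have := ge_of_tendsto hlim hev
  rwa [hf] at this

/-- The degree bound: the coefficient of `X^{u-1}` in `modelPoly u` is `I_u(u) = 0` by (C2). -/
private lemma sz_natDegree_le (hC : DensityCalculus) (u : ℕ) : (modelPoly u).natDegree ≤ u - 2 := by
  rw [natDegree_le_iff_coeff_eq_zero]
  intro i hi
  rw [modelPoly_coeff]
  split_ifs with h
  · obtain ⟨j, rfl⟩ : ∃ j, i = j + 1 := ⟨i - 1, by omega⟩
    apply hC.2.1 j
    have : u ≤ j + 2 := by omega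
    exact_mod_cast this
  · rfl

/-! ## The registered stub (name and statement EXACTLY as registered) -/

/-- **`stub_simpleZeros` (registered).** Granted the density calculus, the window chain and the
no-null-window property, `modelPoly u` has degree `≤ u - 2` and at least `u - 2` distinct real roots
for every integer `u ≥ 2` (reality from non-vanishing on the upper half-plane + conjugation;
simplicity by the pole-order argument along rays at a multiple root + `NoNullWindow`). -/
theorem stub_simpleZeros : SimpleZerosStep := by
  intro hC hW hNull u hu
  have hdeg : (modelPoly u).natDegree ≤ u - 2 := sz_natDegree_le hC u
  refine ⟨hdeg, ?_⟩
  rcases (show u = 2 ∨ 3 ≤ u by omega) with rfl | hu3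
  · simp
  -- from now on `u ≥ 3`
  have hu1 : (1 : ℝ) ≤ u := by exact_mod_cast (show 1 ≤ u by omega)
  have hu2 : (2 : ℝ) ≤ u := by exact_mod_cast (show 2 ≤ u by omega)
  -- (a) the degree is exactly `u - 2`
  have hcoef : (modelPoly u).coeff (u - 2) ≠ 0 := by
    rw [modelPoly_coeff, if_pos (by omega)]
    refine (hC.2.2.1 (u - 2) u ?_).ne'
    rw [Nat.cast_sub (by omega : 2 ≤ u)]
    push_cast
    linarith
  have hnat : (modelPoly u).natDegree = u - 2 := natDegree_eq_of_le_of_coeff_ne_zero hdeg hcoef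
  have hp0 : modelPoly u ≠ 0 := fun h => hcoef (by rw [h, coeff_zero])
  obtain ⟨P, hP⟩ : ∃ P : ℂ[X], P = (modelPoly u).map (algebraMap ℝ ℂ) := ⟨_, rfl⟩
  have hP0 : P ≠ 0 := by
    rw [hP]
    exact (Polynomial.map_ne_zero_iff (algebraMap ℝ ℂ).injective).mpr hp0
  have hPeval : ∀ z : ℂ, P.eval z = modelEval u u z := by
    intro z
    rw [hP, modelPoly_map_eval]
  have hPcard : P.roots.card = u - 2 := by
    rw [IsAlgClosed.card_roots_eq_natDegree, hP, natDegree_map, hnat]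
  -- (b) REALITY: every complex root of `P` is real
  have hreal : ∀ z : ℂ, P.IsRoot z → z.im = 0 := by
    intro z hz
    rw [IsRoot.def, hPeval] at hz
    rcases lt_trichotomy z.im 0 with hneg | h0 | hpos
    · exfalso
      refine (hW u u u hu1 le_rfl (by linarith) le_rfl ((starRingEnd ℂ) z) ?_).1 ?_
      · rw [Complex.conj_im]
        linarith
      · rw [sz_modelEval_conj, hz, map_zero]
    · exact h0
    · exact absurd hz (hW u u u hu1 le_rfl (by linarith) le_rfl z hpos).1
  -- (c) SIMPLICITY: every root of `P` is simple
  have hmult : ∀ z₀ : ℂ, P.rootMultiplicity z₀ ≤ 1 := by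
    intro z₀
    by_contra hcon
    rw [not_le] at hcon
    have hroot : P.IsRoot z₀ := by
      by_contra h
      rw [rootMultiplicity_eq_zero h] at hcon
      omega
    have hz₀im : z₀.im = 0 := hreal z₀ hroot
    have hz₀ne : z₀ ≠ 0 := by
      rintro rfl
      have h1 : P.eval 0 = 1 := by rw [hPeval, modelEval_zero_right (by omega)]
      rw [IsRoot.def, h1] at hroot
      exact one_ne_zero hroot
    obtain ⟨Q, hPQ, hndvd⟩ := P.exists_eq_pow_rootMultiplicity_mul_and_not_dvd hP0 z₀
    set m := P.rootMultiplicity z₀ with hm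
    have hQ0 : Q.eval z₀ ≠ 0 := by rwa [dvd_iff_isRoot] at hndvd
    have hfac : ∀ z : ℂ, modelEval u u z = (z - z₀) ^ m * Q.eval z := by
      intro z
      rw [← hPeval]
      conv_lhs => rw [hPQ]
      rw [eval_mul, eval_pow, eval_sub, eval_X, eval_C]
    -- the CLAIM: `G_u(τ; z₀) = 0` on the whole window `[u-1, u]`
    have hclaim : ∀ τ : ℝ, (u : ℝ) - 1 ≤ τ → τ ≤ u → modelEval u τ z₀ = 0 := by
      intro τ hτ1 hτ2
      have hd : z₀ * modelEval u τ z₀ / Q.eval z₀ = 0 := by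
        refine sz_eq_zero_of_forall_angle hcon fun θ hθ hθ' => ?_
        refine sz_ray (G := modelEval u τ) (H := fun z => Q.eval z) (sz_continuous_modelEval u τ)
          Q.continuous hz₀im hQ0 (fun z hz => ?_) hθ hθ'
        have := (hW u τ u (by linarith) hτ2 (by linarith) le_rfl z hz).2.2.2
        rwa [hfac z] at this
      rcases div_eq_zero_iff.mp hd with h | h
      · exact (mul_eq_zero.mp h).resolve_left hz₀ne
      · exact absurd h hQ0
    obtain ⟨τ, ⟨hτ1, hτ2⟩, hne⟩ :=
      hNull u z₀ hz₀ne ((u : ℝ) - 1) (by linarith) (by linarith)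
    exact hne (hclaim τ hτ1 (by linarith))
  -- conclusion: `P` has `u - 2` simple roots, all real, hence so has `modelPoly u`
  classical
  have hnodup : P.roots.Nodup := by
    refine Multiset.nodup_iff_count_le_one.mpr fun z => ?_
    rw [count_roots]
    exact hmult z
  have hcardF : P.roots.toFinset.card = u - 2 := by
    rw [Multiset.toFinset_card_of_nodup hnodup, hPcard]
  have hmaps : Set.MapsTo (fun z : ℂ => z.re) (P.roots.toFinset : Set ℂ)
      ((modelPoly u).roots.toFinset : Set ℝ) := by
    intro z hz
    simp only [Finset.mem_coe, Multiset.mem_toFinset] at hz ⊢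
    rw [mem_roots hP0] at hz
    rw [mem_roots hp0, IsRoot.def]
    have hzre : z = algebraMap ℝ ℂ z.re := by
      apply Complex.ext
      · simp
      · simp [hreal z hz]
    have h1 : P.eval (algebraMap ℝ ℂ z.re) = algebraMap ℝ ℂ ((modelPoly u).eval z.re) := by
      rw [hP, eval_map, eval₂_at_apply]
    rw [← hzre, hz.eq_zero] at h1
    exact (algebraMap ℝ ℂ).injective (by rw [map_zero]; exact h1.symm)
  have hinj : Set.InjOn (fun z : ℂ => z.re) (P.roots.toFinset : Set ℂ) := by
    intro z hz w hw hzw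
    simp only [Finset.mem_coe, Multiset.mem_toFinset] at hz hw
    rw [mem_roots hP0] at hz hw
    exact Complex.ext hzw (by rw [hreal z hz, hreal w hw])
  calc u - 2 = P.roots.toFinset.card := hcardF.symm
    _ ≤ (modelPoly u).roots.toFinset.card := Finset.card_le_card_of_injOn _ hmaps hinj

end Summit.Parity.GeneralizedHardyLittlewood.Cruxes.ModelHyperbolicity.WindowChainTransport

end
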